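import Summits.QuantumFields.YangMills.Theorems.BalabanUVNodesN18ThreeBlockBoxGauge
import Summits.QuantumFields.YangMills.Theorems.BalabanUVNodesN18CombStepBaseChange
import Literature.MathematicalPhysics.QuantumFieldTheory.Balaban1983to89.B12RegularSpaces111Gauge
import HarnessLib

/-!
# N18 (β)-transport letters: THE C¹ MAIN TERM — the straight block means of `Ad(v₀)A′` at adjacent coarse bonds differ by `L·(η·|∇^η_U A′| + 2t·|A′|)`

[DAGN18W3-G5 INTENT-4, file (4b)] — count-neutral helper toward K3⁸ `stmt-QuantumFields-27366` (K3⁷ `stmt-QuantumFields-20544` aside; NOT claimed, NOT closed).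
YM mass gap (Clay) NOT proved by any of this; R4 closes the conditional finite-𝕋⁴ rung `BalabanLadder.UV` only.

WHY.  The C¹ cancelled sum `|∇^ξ_{U_A,ν}(A′_A − i∇l)(·,μ)|` of FILE 7 ∕ G compares the transported pair's potential at the adjacent coarse bonds `c = ⟨x̂, μ⟩`, `c′ = ⟨x̂+e_ν, μ⟩`.
Its main term is `(η∕ξ)·L·[(QY)(c′) − (QY)(c)]∕ξ`, `Y = Ad(v₀)A′` in ONE axial gauge `v₀ = axialT U (emb x̂)` on the pair box of file (4a), `Q = LatticeFieldCalculus.bondAvg`.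
[Balaban1985Averaging] Prop. 3 p. 36 («|∇(Ū − 1)| ≤ c(|∇A| + …)»): the difference telescopes along `e_ν` — `(QY)(c′) − (QY)(c) = Q(Y∘τ_{Le_ν} − Y)(c)` (g2
`bondAvg_translate_shift`) and `Y(b + Le_ν) − Y(b) = Σ_{i<L}(Y(b + (i+1)e_ν) − Y(b + ie_ν))` — and each unit difference is `η·∇^η_{V₀,ν}Y(b) − (V₀YV₀⁻¹ − Y)` with
`V₀ = U^{v₀}` within `t` of `1` on the pair box ((4a) ★), `∇^η_{V₀,ν}(Ad(v₀)A′) = Ad(v₀)∇^η_{U,ν}A′` EXACTLY (B12RegularSpaces111Gauge `nabla_gaugeU_adJ`).  Hence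
★ `‖(QY)(c′) − (QY)(c)‖ ≤ L·(η·a₁ + 2t·a)` from `|∇^η_U A′| ≤ a₁` on the pair box's direction pairs and `|A′| ≤ a` there — the coefficient of `a₁` is `Lη`, so after the
prefactor `ηL∕ξ²` of the C¹ sum the derivative radius transports with coefficient `L²η²∕ξ² = 1`.

WHAT (ns `YMDAG.N18.TransportOfRecord`): `norm_sub_translate_nsmul_le` (pointwise telescoping bound), `bondAvg_shift_sub_eq` (`(QY)(c′) − (QY)(c) = Q(Y∘τ_L − Y)(c)`),
`norm_bondAvg_shift_sub_le_of_steps` (`≤ L·D`), `sub_shift_eq_eta_nabla_sub_conj` (unit difference vs `η∇^η`), `norm_sub_shift_le` (`≤ η|∇^η_U A′| + 2‖V₀ − 1‖·|A′|` for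
`Y = Ad(v₀)A′`), `blockOf_add_nsmul_shift_mem_pairBlocks` (the `e_ν`-sweep of the two-block bonds stays in the pair blocks), ★ `norm_bondAvg_adJ_axialT_shift_sub_le`.

0 `def`, 0 `sorry`.  References: T. Bałaban, CMP **98** (1985) [Balaban1985Averaging] ((8)–(9) pp.18–19, pp.24–25, Prop. 3 (122)–(126) p.36); CMP **95** (1984)
[Balaban1984PropagatorsI] ((1.8)–(1.11) p.19); CMP **109** (1987) [Balaban1987RG1] ((0.4) p.253, (1.10)–(1.13) p.262).
-/

noncomputable section

open scoped BigOperators Matrix.Norms.L2Operator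

namespace YMDAG.N18.TransportOfRecord

open Literature.MathematicalPhysics.QuantumFieldTheory.Balaban1983to89
open Literature.MathematicalPhysics.QuantumFieldTheory.Balaban1983to89.T4Continuum
open Literature.MathematicalPhysics.QuantumFieldTheory.Balaban1983to89.BlockAveraging
open Literature.MathematicalPhysics.QuantumFieldTheory.Balaban1983to89.LatticeFieldCalculus (bondAvg segSum runBond)
open Literature.MathematicalPhysics.QuantumFieldTheory.Balaban1983to89.B12RegularSpaces111 (gaugeU adJ plaq plaq_eq nabla)
open Literature.MathematicalPhysics.QuantumFieldTheory.Balaban1983to89.B12RegularSpaces111Gauge (nabla_gaugeU_adJ)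
open Literature.MathematicalPhysics.QuantumFieldTheory.Balaban1983to89.B7Prop1Explicit renaming Site → LSite
open Literature.MathematicalPhysics.QuantumFieldTheory.Balaban1983to89.B7Prop1Explicit (e e_apply l1 U1 mem_U1 norm_inv_sub_one_le)
open Literature.MathematicalPhysics.QuantumFieldTheory.Balaban1983to89.B7Prop1Local (InBox)
open Literature.MathematicalPhysics.QuantumFieldTheory.Balaban1983to89.B10Eq27TorusAxialLog (transl transl_apply transl_add_e rel rel_transl_of_mem axialT)
open Literature.MathematicalPhysics.QuantumFieldTheory.Balaban1983to89.T4TermwiseBCH (norm_units_conj_le)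
open YMDAG.N18.AvgPotential (bondAvg_congr₂)

variable {P : Params} {j : ℕ}

/-! ## §1 Telescoping of the straight block average along `e_ν` -/

section Telescoping

variable {V : Type*} [SeminormedAddCommGroup V]

/-- **Pointwise telescoping**: `‖Y(b + Ls) − Y(b)‖ ≤ L·D` if each unit step `‖Y(b + (i+1)s) − Y(b + is)‖ ≤ D`, `i < L`. [cite: Balaban1984PropagatorsI, (1.8) p.19] -/
theorem norm_sub_translate_nsmul_le (Y : PBond P j → V) (s : Site P j) (b : PBond P j) {D : ℝ} :
    ∀ m : ℕ, (∀ i < m, ‖Y ((b.translate (i • s)).translate s) - Y (b.translate (i • s))‖ ≤ D) →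
      ‖Y (b.translate (m • s)) - Y b‖ ≤ m * D
  | 0, _ => by simp [PBond.translate]
  | m + 1, h => by
    have ih := norm_sub_translate_nsmul_le Y s b m fun i hi => h i (Nat.lt_succ_of_lt hi)
    have hm := h m (Nat.lt_succ_self m)
    have hsplit : Y (b.translate ((m + 1) • s)) - Y b =
        (Y ((b.translate (m • s)).translate s) - Y (b.translate (m • s))) + (Y (b.translate (m • s)) - Y b) := by
      rw [PBond.translate_translate, ← succ_nsmul]; abel
    rw [hsplit, Nat.cast_succ, add_mul, one_mul, add_comm ((m : ℝ) * D)]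
    exact (norm_add_le _ _).trans (add_le_add hm ih)

end Telescoping

section BondAvg

variable {n : Type*} [Fintype n] [DecidableEq n] [Nonempty n]

omit [Fintype n] [DecidableEq n] [Nonempty n] in
/-- **`(QY)(c′) − (QY)(c) = Q(Y∘τ_{Le_ν} − Y)(c)`** for `c = ⟨y, μ⟩`, `c′ = ⟨y + e_ν, μ⟩` (g2 `bondAvg_translate_shift` + linearity of `Q`). [cite: Balaban1984PropagatorsI, (1.11) p.19] -/
theorem bondAvg_shift_sub_eq (Y : PBond P j → Matrix n n ℂ) (y : Site P (j + 1)) (μ ν : Fin P.d) :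
    bondAvg Y ⟨y.shift ν, μ⟩ - bondAvg Y ⟨y, μ⟩ = bondAvg (fun b => Y (b.translate (P.L • (0 : Site P j).shift ν)) - Y b) ⟨y, μ⟩ := by
  rw [← YMDAG.N18.AvgPotential.bondAvg_translate_shift Y y μ ν]
  simp only [bondAvg, segSum, Finset.sum_sub_distrib, smul_sub]

omit [Nonempty n] in
/-- **The telescoped bound**: if along the `e_ν`-sweep of every two-block bond of `c = ⟨y, μ⟩` the unit differences of `Y` are `≤ D`, then `‖(QY)(c′) − (QY)(c)‖ ≤ L·D`.
[cite: Balaban1985Averaging, Prop. 3 p.36; Balaban1984PropagatorsI, (1.11) p.19] -/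
theorem norm_bondAvg_shift_sub_le_of_steps (hj : j + 1 ≤ P.m + P.K) (Y : PBond P j → Matrix n n ℂ) (y : Site P (j + 1)) (μ ν : Fin P.d) {D : ℝ} (hD0 : 0 ≤ D)
    (hD : ∀ b : PBond P j, (blockOf b.src = y ∨ blockOf b.src = y.shift μ) → (blockOf b.tgt = y ∨ blockOf b.tgt = y.shift μ) →
      ∀ i < P.L, ‖Y ((b.translate (i • (0 : Site P j).shift ν)).translate ((0 : Site P j).shift ν)) - Y (b.translate (i • (0 : Site P j).shift ν))‖ ≤ D) :
    ‖bondAvg Y ⟨y.shift ν, μ⟩ - bondAvg Y ⟨y, μ⟩‖ ≤ (P.L : ℝ) * D := by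
  classical
  rw [bondAvg_shift_sub_eq]
  let Z : PBond P j → Matrix n n ℂ := fun b =>
    if (blockOf b.src = y ∨ blockOf b.src = y.shift μ) ∧ (blockOf b.tgt = y ∨ blockOf b.tgt = y.shift μ) then
      Y (b.translate (P.L • (0 : Site P j).shift ν)) - Y b else 0
  have hZ : ∀ b, ‖Z b‖ ≤ (P.L : ℝ) * D := fun b => by
    by_cases hb : (blockOf b.src = y ∨ blockOf b.src = y.shift μ) ∧ (blockOf b.tgt = y ∨ blockOf b.tgt = y.shift μ)
    · simp only [Z, if_pos hb]
      exact norm_sub_translate_nsmul_le Y _ b P.L (hD b hb.1 hb.2)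
    · simp only [Z, if_neg hb, norm_zero]; positivity
  have hcongr : bondAvg (fun b => Y (b.translate (P.L • (0 : Site P j).shift ν)) - Y b) (⟨y, μ⟩ : PBond P (j + 1)) = bondAvg Z ⟨y, μ⟩ :=
    bondAvg_congr₂ hj _ fun b h1 h2 => by
      have hb : (blockOf b.src = y ∨ blockOf b.src = y.shift μ) ∧ (blockOf b.tgt = y ∨ blockOf b.tgt = y.shift μ) := ⟨h1, h2⟩
      simp only [Z, if_pos hb]
  rw [hcongr]
  exact norm_bondAvg_le_of_bound Z hZ _

end BondAvg

/-! ## §2 The unit difference along `e_ν` versus the covariant derivative -/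

section Pointwise

variable {n : Type*} [Fintype n] [DecidableEq n] [Nonempty n]

omit [Nonempty n] in
/-- **`Y(b + e_ν) − Y(b) = η·∇^η_{V,ν}Y(b) − (V·Y(b+e_ν)·V⁻¹ − Y(b+e_ν))`**, `V = V(b₋, ν)`, for any bond field `Y` read as the site function `w ↦ Y⟨w, κ⟩`.
[cite: Balaban1987RG1, (1.13) p.262] -/
theorem sub_shift_eq_eta_nabla_sub_conj {η : ℝ} (hη : η ≠ 0) (V : PBond P j → (Matrix n n ℂ)ˣ) (Y : PBond P j → Matrix n n ℂ) (z : Site P j) (ν κ : Fin P.d) :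
    Y ⟨z.shift ν, κ⟩ - Y ⟨z, κ⟩ = (η : ℂ) • nabla η V ν (fun w => Y ⟨w, κ⟩) z -
      (((V ⟨z, ν⟩ : (Matrix n n ℂ)ˣ) : Matrix n n ℂ) * Y ⟨z.shift ν, κ⟩ * (((V ⟨z, ν⟩)⁻¹ : (Matrix n n ℂ)ˣ) : Matrix n n ℂ) - Y ⟨z.shift ν, κ⟩) := by
  unfold nabla
  rw [smul_smul, mul_inv_cancel₀ (by exact_mod_cast hη), one_smul]
  abel

omit [Nonempty n] in
/-- `‖VZV⁻¹ − Z‖ ≤ 2‖V − 1‖·‖Z‖` for bi-contractive `V`. [folklore] -/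
theorem norm_conj_sub_le_of_U1 [Nonempty n] {V : (Matrix n n ℂ)ˣ} (hV : V ∈ U1 (Matrix n n ℂ)) (Z : Matrix n n ℂ) :
    ‖(V : Matrix n n ℂ) * Z * ((V⁻¹ : (Matrix n n ℂ)ˣ) : Matrix n n ℂ) - Z‖ ≤ 2 * ‖(V : Matrix n n ℂ) - 1‖ * ‖Z‖ := by
  have h := norm_inv_conj_sub_le_of_U1 ((U1 _).inv_mem hV) Z
  rw [inv_inv] at h
  refine h.trans ?_
  have h2 := norm_inv_sub_one_le hV
  nlinarith [norm_nonneg Z]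

/-- **The unit difference of `Y = Ad(v)A′` along `e_ν`** at a bond `b = ⟨z, κ⟩`: `‖Y(b + e_ν) − Y(b)‖ ≤ η·‖∇^η_{U,ν}A′_κ(z)‖ + 2‖U^{v}(z,ν) − 1‖·‖A′(b + e_ν)‖`, by the identity
above for `V = U^{v}` and the exact covariance `∇^η_{U^v}(Ad(v)A′) = Ad(v)·∇^η_U A′` (`nabla_gaugeU_adJ`), for bi-contractive `v(z)`, `v(z+e_ν)`, `U^v(z,ν)`.
[cite: Balaban1987RG1, (1.10)-(1.13) p.262; Balaban1985Averaging, Prop. 3 p.36] -/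
theorem norm_sub_shift_le {η : ℝ} (hη : 0 < η) (v : Site P j → (Matrix n n ℂ)ˣ) (U : PBond P j → (Matrix n n ℂ)ˣ) (A : PBond P j → Matrix n n ℂ)
    (z : Site P j) (ν κ : Fin P.d) (hvz : v z ∈ U1 (Matrix n n ℂ)) (hvz' : v (z.shift ν) ∈ U1 (Matrix n n ℂ))
    (hV : gaugeU v U ⟨z, ν⟩ ∈ U1 (Matrix n n ℂ)) :
    ‖adJ v A ⟨z.shift ν, κ⟩ - adJ v A ⟨z, κ⟩‖ ≤
      η * ‖nabla η U ν (fun w => A ⟨w, κ⟩) z‖ + 2 * ‖((gaugeU v U ⟨z, ν⟩ : (Matrix n n ℂ)ˣ) : Matrix n n ℂ) - 1‖ * ‖A ⟨z.shift ν, κ⟩‖ := by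
  rw [sub_shift_eq_eta_nabla_sub_conj hη.ne' (gaugeU v U) (adJ v A) z ν κ]
  refine (norm_sub_le _ _).trans (add_le_add ?_ ?_)
  · rw [norm_smul, Complex.norm_real, Real.norm_of_nonneg hη.le]
    refine mul_le_mul_of_nonneg_left ?_ hη.le
    have hcov := nabla_gaugeU_adJ η v U ν κ A z
    rw [hcov]
    exact norm_units_conj_le hvz _
  · refine (norm_conj_sub_le_of_U1 hV _).trans (mul_le_mul_of_nonneg_left ?_ (by positivity))
    exact norm_units_conj_le hvz' _

end Pointwise

/-! ## §3 The main term on the pair box -/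

section MainTerm

/-- Translation by `i` unit steps `e_ν` is the integer translate by `i·e_ν`. [folklore] -/
theorem add_nsmul_zero_shift_eq_transl (x : Site P j) (ν : Fin P.d) : ∀ i : ℕ, x + i • (0 : Site P j).shift ν = transl x ((i : ℤ) • e ν)
  | 0 => by simp [B10Eq27TorusAxialLog.transl_zero]
  | i + 1 => by
    rw [succ_nsmul, ← add_assoc, Site.add_zero_shift, add_nsmul_zero_shift_eq_transl x ν i, Nat.cast_succ, add_smul, one_smul, transl_add_e]

/-- **The `e_ν`-sweep of the two blocks stays in the pair blocks**: if `blockOf x ∈ {y, y+e_μ}` then `blockOf (x + i·e_ν) ∈ {y, y+e_μ, y+e_ν, y+e_μ+e_ν}` for `i ≤ L`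
(`j + 2 ≤ m + K`). [cite: Balaban1987RG1, (0.3)-(0.4) pp.252-253] -/
theorem blockOf_add_nsmul_shift_mem_pairBlocks (hj : j + 1 ≤ P.m + P.K) (hj2 : j + 2 ≤ P.m + P.K) (y : Site P (j + 1)) (μ ν : Fin P.d) {x : Site P j}
    (hx : blockOf x = y ∨ blockOf x = y.shift μ) {i : ℕ} (hi : i ≤ P.L) :
    blockOf (x + i • (0 : Site P j).shift ν) = y ∨ blockOf (x + i • (0 : Site P j).shift ν) = y.shift μ ∨
      blockOf (x + i • (0 : Site P j).shift ν) = y.shift ν ∨ blockOf (x + i • (0 : Site P j).shift ν) = (y.shift μ).shift ν := by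
  -- `x = emb y + z` with `z` in the two-block box of `⟨y, μ⟩`
  have hz := inBox_rel_of_twoBlock hj hj2 (⟨y, μ⟩ : PBond P (j + 1)) (x := x) hx
  have hx' : x + i • (0 : Site P j).shift ν = transl (emb y) (rel (emb y) x + (i : ℤ) • e ν) := by
    rw [add_nsmul_zero_shift_eq_transl, B10Eq27TorusAxialLog.transl_add, B10Eq27TorusAxialLog.transl_rel]
  rw [hx']
  refine blockOf_transl_emb_pairBox hj y μ ν fun κ => ?_
  have h1 := (hz κ).1; have h2 := (hz κ).2
  dsimp only at h1 h2 ⊢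
  rw [Pi.add_apply, Pi.smul_apply, e_apply, smul_eq_mul]
  have hi' : (i : ℤ) ≤ P.L := by exact_mod_cast hi
  by_cases hκν : κ = ν
  · subst hκν
    simp only [if_true, mul_one]
    by_cases hκμ : κ = μ
    · subst hκμ; simp only [if_true] at h2 ⊢; constructor <;> omega
    · rw [if_neg (Ne.symm hκμ)] at h2; simp only [if_neg hκμ]; constructor <;> omega
  · simp only [if_neg hκν, mul_zero, add_zero]
    by_cases hκμ : κ = μ
    · subst hκμ; simp only [if_true] at h2 ⊢; constructor <;> omega
    · rw [if_neg (Ne.symm hκμ)] at h2; simp only [if_neg hκμ]; constructor <;> omega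

variable {n : Type*} [Fintype n] [DecidableEq n] [Nonempty n]

/-- ★ **THE C¹ MAIN TERM ON THE PAIR BOX.**  Let `c = ⟨y, μ⟩`, `ν` a direction (`μ = ν` allowed), `U ∈ U1` on the bonds with both ends in the pair blocks
`{y, y+e_μ, y+e_ν, y+e_μ+e_ν}` with `‖∂U(p) − 1‖ ≤ α` on the plaquettes with four corners there, `((d+4)L∕2)·α ≤ t`; `|A′| ≤ a` on those bonds and `|∇^η_{U,ν}A′_κ(z)| ≤ a₁`
whenever `z, z+e_ν, z+e_κ, z+e_ν+e_κ` lie in the pair blocks.  Then with `v₀ = axialT U (emb y)` and `Y = Ad(v₀)A′`: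
`‖(QY)(⟨y+e_ν, μ⟩) − (QY)(⟨y, μ⟩)‖ ≤ L·(η·a₁ + 2t·a)` (`j + 2 ≤ m + K`).  Telescoping (§1) + the unit-difference letter (§2) with `V₀ = U^{v₀}` within `t` on the pair box
((4a) ★ on the factor cut off to `1` off the pair blocks). [cite: Balaban1985Averaging, Prop. 3 (126) p.36, pp.24-25; Balaban1984PropagatorsI, (1.11) p.19; Balaban1987RG1, (1.13) p.262] -/
theorem norm_bondAvg_adJ_axialT_shift_sub_le (hj : j + 1 ≤ P.m + P.K) (hj2 : j + 2 ≤ P.m + P.K) (y : Site P (j + 1)) (μ ν : Fin P.d)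
    {U : GaugeField P j (Matrix n n ℂ)ˣ} {A : PBond P j → Matrix n n ℂ} {η a a₁ α t : ℝ} (hη : 0 < η) (ha0 : 0 ≤ a) (ha1 : 0 ≤ a₁) (hα : 0 ≤ α)
    (hU1 : ∀ b : PBond P j, (blockOf b.src = y ∨ blockOf b.src = y.shift μ ∨ blockOf b.src = y.shift ν ∨ blockOf b.src = (y.shift μ).shift ν) →
      (blockOf b.tgt = y ∨ blockOf b.tgt = y.shift μ ∨ blockOf b.tgt = y.shift ν ∨ blockOf b.tgt = (y.shift μ).shift ν) → U b ∈ U1 (Matrix n n ℂ))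
    (hplaq : ∀ p : Plaq P j, (blockOf p.src = y ∨ blockOf p.src = y.shift μ ∨ blockOf p.src = y.shift ν ∨ blockOf p.src = (y.shift μ).shift ν) →
      (blockOf (p.src.shift p.μ) = y ∨ blockOf (p.src.shift p.μ) = y.shift μ ∨ blockOf (p.src.shift p.μ) = y.shift ν ∨
        blockOf (p.src.shift p.μ) = (y.shift μ).shift ν) →
      (blockOf (p.src.shift p.ν) = y ∨ blockOf (p.src.shift p.ν) = y.shift μ ∨ blockOf (p.src.shift p.ν) = y.shift ν ∨
        blockOf (p.src.shift p.ν) = (y.shift μ).shift ν) →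
      (blockOf ((p.src.shift p.μ).shift p.ν) = y ∨ blockOf ((p.src.shift p.μ).shift p.ν) = y.shift μ ∨
        blockOf ((p.src.shift p.μ).shift p.ν) = y.shift ν ∨ blockOf ((p.src.shift p.μ).shift p.ν) = (y.shift μ).shift ν) →
      ‖((plaq U p : (Matrix n n ℂ)ˣ) : Matrix n n ℂ) - 1‖ ≤ α)
    (hA : ∀ b : PBond P j, (blockOf b.src = y ∨ blockOf b.src = y.shift μ ∨ blockOf b.src = y.shift ν ∨ blockOf b.src = (y.shift μ).shift ν) →
      (blockOf b.tgt = y ∨ blockOf b.tgt = y.shift μ ∨ blockOf b.tgt = y.shift ν ∨ blockOf b.tgt = (y.shift μ).shift ν) → ‖A b‖ ≤ a)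
    (hA1 : ∀ (z : Site P j) (κ : Fin P.d),
      (blockOf z = y ∨ blockOf z = y.shift μ ∨ blockOf z = y.shift ν ∨ blockOf z = (y.shift μ).shift ν) →
      (blockOf (z.shift ν) = y ∨ blockOf (z.shift ν) = y.shift μ ∨ blockOf (z.shift ν) = y.shift ν ∨ blockOf (z.shift ν) = (y.shift μ).shift ν) →
      (blockOf (z.shift κ) = y ∨ blockOf (z.shift κ) = y.shift μ ∨ blockOf (z.shift κ) = y.shift ν ∨ blockOf (z.shift κ) = (y.shift μ).shift ν) →
      (blockOf ((z.shift ν).shift κ) = y ∨ blockOf ((z.shift ν).shift κ) = y.shift μ ∨ blockOf ((z.shift ν).shift κ) = y.shift ν ∨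
        blockOf ((z.shift ν).shift κ) = (y.shift μ).shift ν) →
      ‖nabla η U ν (fun w => A ⟨w, κ⟩) z‖ ≤ a₁)
    (hRt : ((((P.d + 4) * P.L : ℕ) : ℝ) / 2) * α ≤ t) :
    ‖bondAvg (adJ (axialT U (emb y)) A) ⟨y.shift ν, μ⟩ - bondAvg (adJ (axialT U (emb y)) A) ⟨y, μ⟩‖ ≤ (P.L : ℝ) * (η * a₁ + 2 * t * a) := by
  classical
  have ht0 : 0 ≤ t := le_trans (by positivity) hRt
  -- the factor cut off to `1` off the pair blocks, its axial gauge (= `v₀` on the blocks), `U^{v₀}` within `t` there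
  let χ : PBond P j → Prop := fun b =>
    (blockOf b.src = y ∨ blockOf b.src = y.shift μ ∨ blockOf b.src = y.shift ν ∨ blockOf b.src = (y.shift μ).shift ν) ∧
    (blockOf b.tgt = y ∨ blockOf b.tgt = y.shift μ ∨ blockOf b.tgt = y.shift ν ∨ blockOf b.tgt = (y.shift μ).shift ν)
  let U' : GaugeField P j (Matrix n n ℂ)ˣ := fun b => if χ b then U b else 1
  have hU'U : ∀ b : PBond P j, (blockOf b.src = y ∨ blockOf b.src = y.shift μ ∨ blockOf b.src = y.shift ν ∨ blockOf b.src = (y.shift μ).shift ν) →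
      (blockOf b.tgt = y ∨ blockOf b.tgt = y.shift μ ∨ blockOf b.tgt = y.shift ν ∨ blockOf b.tgt = (y.shift μ).shift ν) → U' b = U b :=
    fun b h1 h2 => by simp only [U', χ, if_pos (And.intro h1 h2)]
  have hU'1 : ∀ b, U' b ∈ U1 (Matrix n n ℂ) := fun b => by
    by_cases hb : χ b
    · simp only [U', if_pos hb]; exact hU1 b hb.1 hb.2
    · simp only [U', if_neg hb]; exact (U1 _).one_mem
  have hplaq' : ∀ p : Plaq P j, (blockOf p.src = y ∨ blockOf p.src = y.shift μ ∨ blockOf p.src = y.shift ν ∨ blockOf p.src = (y.shift μ).shift ν) →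
      (blockOf (p.src.shift p.μ) = y ∨ blockOf (p.src.shift p.μ) = y.shift μ ∨ blockOf (p.src.shift p.μ) = y.shift ν ∨
        blockOf (p.src.shift p.μ) = (y.shift μ).shift ν) →
      (blockOf (p.src.shift p.ν) = y ∨ blockOf (p.src.shift p.ν) = y.shift μ ∨ blockOf (p.src.shift p.ν) = y.shift ν ∨
        blockOf (p.src.shift p.ν) = (y.shift μ).shift ν) →
      (blockOf ((p.src.shift p.μ).shift p.ν) = y ∨ blockOf ((p.src.shift p.μ).shift p.ν) = y.shift μ ∨
        blockOf ((p.src.shift p.μ).shift p.ν) = y.shift ν ∨ blockOf ((p.src.shift p.μ).shift p.ν) = (y.shift μ).shift ν) →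
      ‖((plaq U' p : (Matrix n n ℂ)ˣ) : Matrix n n ℂ) - 1‖ ≤ α := fun p c1 c2 c3 c4 => by
    have hpe : plaq U' p = plaq U p := by
      rw [plaq_eq, plaq_eq, hU'U ⟨p.src, p.μ⟩ c1 c2, hU'U ⟨p.src.shift p.μ, p.ν⟩ c2 c4, hU'U ⟨p.src, p.ν⟩ c1 c3,
        hU'U ⟨p.src.shift p.ν, p.μ⟩ c3 (by rw [PBond.tgt, Site.shift_comm]; exact c4)]
    rw [hpe]; exact hplaq p c1 c2 c3 c4
  set v₀ : Site P j → (Matrix n n ℂ)ˣ := axialT U (emb y) with hv₀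
  have hvv' : ∀ x : Site P j, (blockOf x = y ∨ blockOf x = y.shift μ ∨ blockOf x = y.shift ν ∨ blockOf x = (y.shift μ).shift ν) →
      v₀ x = axialT U' (emb y) x := fun x hx => (axialT_congr_of_pairBlocks hj hj2 y μ ν hU'U hx).symm
  have hv1 : ∀ x : Site P j, (blockOf x = y ∨ blockOf x = y.shift μ ∨ blockOf x = y.shift ν ∨ blockOf x = (y.shift μ).shift ν) →
      v₀ x ∈ U1 (Matrix n n ℂ) := fun x hx => by rw [hvv' x hx]; exact axialT_mem_U1 hU'1 _ x
  have hV₀ : ∀ b : PBond P j, (blockOf b.src = y ∨ blockOf b.src = y.shift μ ∨ blockOf b.src = y.shift ν ∨ blockOf b.src = (y.shift μ).shift ν) →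
      (blockOf b.tgt = y ∨ blockOf b.tgt = y.shift μ ∨ blockOf b.tgt = y.shift ν ∨ blockOf b.tgt = (y.shift μ).shift ν) →
      gaugeU v₀ U b ∈ U1 (Matrix n n ℂ) ∧ ‖((gaugeU v₀ U b : (Matrix n n ℂ)ˣ) : Matrix n n ℂ) - 1‖ ≤ t := fun b h1 h2 => by
    have heq : gaugeU v₀ U b = gaugeU (axialT U' (emb y)) U' b := by
      simp only [gaugeU, hvv' b.src h1, hvv' b.tgt h2, hU'U b h1 h2]
    rw [heq]
    refine ⟨(U1 _).mul_mem ((U1 _).mul_mem (axialT_mem_U1 hU'1 _ _) (hU'1 b)) ((U1 _).inv_mem (axialT_mem_U1 hU'1 _ _)), ?_⟩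
    exact (norm_gaugeU_axialT_sub_one_le_of_pairBlocks hj hj2 hU'1 y μ ν hα hplaq' b h1 h2).trans hRt
  -- the unit differences along the sweep
  refine norm_bondAvg_shift_sub_le_of_steps hj _ y μ ν (by positivity) fun b h1 h2 i hi => ?_
  -- the swept bond `bᵢ = b + i e_ν` and its endpoints / shifts are in the pair blocks
  set z : Site P j := b.src + i • (0 : Site P j).shift ν with hz
  have hbi : b.translate (i • (0 : Site P j).shift ν) = ⟨z, b.dir⟩ := rfl
  have hbi' : (b.translate (i • (0 : Site P j).shift ν)).translate ((0 : Site P j).shift ν) = ⟨z.shift ν, b.dir⟩ := by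
    rw [PBond.translate_translate]; show (⟨b.src + (i • (0 : Site P j).shift ν + (0 : Site P j).shift ν), b.dir⟩ : PBond P j) = _
    rw [← add_assoc, ← hz, Site.add_zero_shift]
  rw [hbi', hbi]
  have hzmem := blockOf_add_nsmul_shift_mem_pairBlocks hj hj2 y μ ν h1 hi.le
  have hzν : blockOf (z.shift ν) = y ∨ blockOf (z.shift ν) = y.shift μ ∨ blockOf (z.shift ν) = y.shift ν ∨ blockOf (z.shift ν) = (y.shift μ).shift ν := by
    have h := blockOf_add_nsmul_shift_mem_pairBlocks hj hj2 y μ ν h1 (Nat.succ_le_of_lt hi)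
    rwa [succ_nsmul, ← add_assoc, ← hz, Site.add_zero_shift] at h
  have hzκ : blockOf (z.shift b.dir) = y ∨ blockOf (z.shift b.dir) = y.shift μ ∨ blockOf (z.shift b.dir) = y.shift ν ∨
      blockOf (z.shift b.dir) = (y.shift μ).shift ν := by
    have h := blockOf_add_nsmul_shift_mem_pairBlocks hj hj2 y μ ν (x := b.tgt) h2 hi.le
    have heq : b.tgt + i • (0 : Site P j).shift ν = z.shift b.dir := by
      rw [hz, PBond.tgt, ← Site.add_zero_shift b.src b.dir, ← Site.add_zero_shift (b.src + i • (0 : Site P j).shift ν) b.dir]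
      abel
    rwa [heq] at h
  have hzνκ : blockOf ((z.shift ν).shift b.dir) = y ∨ blockOf ((z.shift ν).shift b.dir) = y.shift μ ∨ blockOf ((z.shift ν).shift b.dir) = y.shift ν ∨
      blockOf ((z.shift ν).shift b.dir) = (y.shift μ).shift ν := by
    have h := blockOf_add_nsmul_shift_mem_pairBlocks hj hj2 y μ ν (x := b.tgt) h2 (Nat.succ_le_of_lt hi)
    have heq : b.tgt + (i + 1) • (0 : Site P j).shift ν = (z.shift ν).shift b.dir := by
      rw [succ_nsmul, hz, PBond.tgt, ← Site.add_zero_shift b.src b.dir,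
        ← Site.add_zero_shift ((b.src + i • (0 : Site P j).shift ν).shift ν) b.dir, ← Site.add_zero_shift (b.src + i • (0 : Site P j).shift ν) ν]
      abel
    rwa [heq] at h
  obtain ⟨hVU1, hVt⟩ := hV₀ ⟨z, ν⟩ hzmem hzν
  have hstep := norm_sub_shift_le hη v₀ U A z ν b.dir (hv1 z hzmem) (hv1 _ hzν) hVU1
  refine hstep.trans ?_
  have h1' := hA1 z b.dir hzmem hzν hzκ hzνκ
  have h2' := hA ⟨z.shift ν, b.dir⟩ hzν hzνκ
  have : 0 ≤ ‖((gaugeU v₀ U ⟨z, ν⟩ : (Matrix n n ℂ)ˣ) : Matrix n n ℂ) - 1‖ := norm_nonneg _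
  nlinarith [mul_le_mul hVt h2' (norm_nonneg _) ht0, norm_nonneg (nabla η U ν (fun w => A ⟨w, b.dir⟩) z)]

end MainTerm

end YMDAG.N18.TransportOfRecord

end
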